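import Literature.AlgebraicGeometry.Motives.AbelianVarietyBlochFiltrationTransfer
import HarnessLib

/-!
# Polynomial maps into `CH₀` and the Bloch filtration: `Gr^l_F CH₀(A) = 0` for `l > dim A`
# from a "polynomial" `0`-cycle of non-zero degree (the algebra)

Voisin II, Lemma 11.30 ("for `l > g = dim A`, `Gr^l_F CH₀(A)` is killed by `l!` and divisible,
hence `0`") is proved in print by hard Lefschetz through a complete-intersection curve. This file
isolates a DIFFERENT sufficient condition for the same conclusion, entirely algebraic given the
skeleton of `Motives/AbelianVarietyBlochFiltration{,Skeleton,Transfer}`, and designed to be fed by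
the theorem of the square (Mumford, *Abelian Varieties*, §6 Cor. 4; the tree's
`AbelianVariety.theoremOfTheSquare_holds`) instead of hard Lefschetz
(`Motives/AbelianVarietyTranslatedHyperplaneSections`):

* `BlochVanishing f e` — for a map `f : G → M` from a commutative group to an abelian group: all
  expanded products `blochGen f u Q s = Σ_{S ⊆ s} (-1)^{|S|} f(u ∏_{i∈S} Qᵢ)` with `|s| ≥ e`
  vanish, i.e. all `e`-fold finite differences of `f` vanish (`f` is "polynomial of degree `< e`").
  Closure properties: constants (`e = 1`), sums, post-composition with additive maps, translation,
  and `BlochVanishing f (e+1) → BlochVanishing (x ↦ f x - f (x a)) e`.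
* `BlochVanishing.mulHom_apply` — **product rule**: if `B : G → (M →+ N)` is a homomorphism
  (`B (x y) = B x + B y`) and `f` has vanishing `e`-fold differences, then `x ↦ B x (f x)` has
  vanishing `(e+1)`-fold differences.
* `blochVanishing_iterOp` — **multi-affine expansion**: for operators
  `O x n : C (n+1) →+ C n` satisfying the "square law" `O (x y) n + O 1 n = O x n + O y n` (the
  shape of the theorem of the square for `c₁(t_x^* 𝒪_A(1)) ∩ -` on Chow groups), the map
  `x ↦ (O x 0 ∘ O x 1 ∘ ⋯ ∘ O x (k-1)) a` has vanishing `(k+1)`-fold differences for every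
  `a : C k` (`blochVanishing_iterOp_const`).
* `sum_smul_blochGen_mem_blochFiltrationOf` — **the filtration consequence**: if the `0`-"cycle"
  `z = Σ_j n_j cls(p_j)` is polynomial of degree `≤ g` under translation, i.e.
  `x ↦ Σ_j n_j cls (p_j x)` has vanishing `(g+1)`-fold differences, then
  `(Σ_j n_j) • blochGen cls u Q s ∈ F^{|s|+1}` for `|s| > g` (translating the base point costs one
  filtration step, `blochGen_sub_blochGen_mul_mem`): `deg z` kills `Gr^l_F` for `l > g`.
* `AbelianVariety.blochFiltration_le_succ_of_blochVanishing` — for a complex abelian variety: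
  such a `z ∈ CH₀(A)` with `deg z ≠ 0` gives `F^l CH₀(A) = F^{l+1} CH₀(A)` for all `l > g`
  (with the divisibility of `A(ℂ)`, `blochFiltration_le_succ_of_smul_mem'`), and
  `Bloch1976_pontryaginPower_eq_zero_of_blochVanishing_of_eventually_eq_bot` — Bloch's theorem
  from such cycles on every `A` plus Voisin's Lemma 11.31 (`F^N CH₀(A) = 0` for some `N`).

Everything is proved; no named fact is introduced (D-0026). The geometric existence of `z`
(`z = c₁(𝒪_A(1))^g ∩ [A]`, of degree `deg A ≠ 0`, polynomial of degree `≤ g` by the theorem of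
the square and the projection formula) is the business of the sequel files.

## References

* [VoisinHodgeII2003] C. Voisin, Hodge Theory and Complex Algebraic Geometry II, CUP 2003,
  §11.3.2, Lemma 11.30 (statement: `Gr^l_F CH₀(A)` is torsion and divisible for `l > g`).
* [MumfordAV1970] D. Mumford, Abelian Varieties (1970), §6 Cor. 4 (theorem of the square).
* [Bloch1976] S. Bloch, Some elementary theorems about algebraic cycles on Abelian varieties,
  Invent. Math. 37 (1976), Thm. 0.1.
-/

noncomputable section

open scoped BigOperators

namespace Literature.AlgebraicGeometry.Motives

/-! ### Maps with vanishing iterated finite differences -/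

section Abstract

variable {G : Type*} [CommGroup G] {M : Type*} [AddCommGroup M]

/-- **Vanishing `e`-fold finite differences.** A map `f : G → M` from a commutative group
(written multiplicatively) to an abelian group has `BlochVanishing f e` if every expanded product
`blochGen f u Q s = Σ_{S ⊆ s} (-1)^{|S|} f (u ∏_{i ∈ S} Qᵢ)` with at least `e` factors vanishes —
the `|s|`-fold finite difference of `f` at `u` in the directions `Qᵢ`; so `f` is "polynomial of
degree `< e`". For `f = (a ↦ {a}) : A(ℂ) → CH₀(A)` and `e = g + 1` this is exactly Bloch's
theorem `I^{⋆(g+1)} = 0` (`blochFiltrationOf_eq_bot_iff`). Families are indexed by `ℕ` in the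
definition; any index type is allowed in `BlochVanishing.blochGen_eq_zero`. [folklore] -/
def BlochVanishing (f : G → M) (e : ℕ) : Prop :=
  ∀ (u : G) (Q : ℕ → G) (s : Finset ℕ), e ≤ s.card → blochGen f u Q s = 0

namespace BlochVanishing

variable {f f' : G → M} {e e' : ℕ}

/-- Vanishing of the expanded products over an arbitrary index type. [folklore] -/
theorem blochGen_eq_zero {κ : Type*} (h : BlochVanishing f e) (u : G) (Q : κ → G) (s : Finset κ)
    (hs : e ≤ s.card) : blochGen f u Q s = 0 := by
  obtain ⟨Q', s', hcard, hQ'⟩ := blochGen_exists_nat f Q s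
  rw [← hQ' u]
  exact h u Q' s' (hcard ▸ hs)

/-- Monotonicity in the number of factors. [folklore] -/
theorem mono (h : BlochVanishing f e) (hle : e ≤ e') : BlochVanishing f e' :=
  fun u Q s hs => h u Q s (hle.trans hs)

/-- The zero map. [folklore] -/
theorem zero : BlochVanishing (0 : G → M) e := fun u Q s _ => by
  simp [blochGen]

/-- Sums. [folklore] -/
theorem add (h : BlochVanishing f e) (h' : BlochVanishing f' e) : BlochVanishing (f + f') e :=
  fun u Q s hs => by
    have : blochGen (f + f') u Q s = blochGen f u Q s + blochGen f' u Q s := by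
      simp only [blochGen, Pi.add_apply, smul_add, Finset.sum_add_distrib]
    rw [this, h u Q s hs, h' u Q s hs, add_zero]

/-- Negatives. [folklore] -/
theorem neg (h : BlochVanishing f e) : BlochVanishing (-f) e := fun u Q s hs => by
  have : blochGen (-f) u Q s = -blochGen f u Q s := by
    simp only [blochGen, Pi.neg_apply, smul_neg, Finset.sum_neg_distrib]
  rw [this, h u Q s hs, neg_zero]

/-- Differences. [folklore] -/
theorem sub (h : BlochVanishing f e) (h' : BlochVanishing f' e) : BlochVanishing (f - f') e := by
  rw [sub_eq_add_neg]; exact h.add h'.neg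

/-- Finite sums. [folklore] -/
theorem sum {ι : Type*} (J : Finset ι) {F : ι → G → M} (h : ∀ j ∈ J, BlochVanishing (F j) e) :
    BlochVanishing (fun x => ∑ j ∈ J, F j x) e := by
  classical
  induction J using Finset.induction_on with
  | empty =>
    have : (fun x : G => ∑ j ∈ (∅ : Finset ι), F j x) = 0 := by ext; simp
    rw [this]; exact zero
  | insert a J ha ih =>
    have : (fun x : G => ∑ j ∈ insert a J, F j x) = F a + fun x => ∑ j ∈ J, F j x := by
      ext x; simp [Finset.sum_insert ha]
    rw [this]
    exact (h a (Finset.mem_insert_self a J)).add (ih fun j hj => h j (Finset.mem_insert_of_mem hj))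

/-- Post-composition with an additive map. [folklore] -/
theorem addMonoidHom_comp {N : Type*} [AddCommGroup N] (h : BlochVanishing f e) (T : M →+ N) :
    BlochVanishing (T ∘ f) e := fun u Q s hs => by
  have key : blochGen (T ∘ f) u Q s = T (blochGen f u Q s) := by
    simp only [blochGen, map_sum, map_zsmul, Function.comp_apply]
  rw [key, h u Q s hs, map_zero]

/-- Translation of the argument. [folklore] -/
theorem mul_right (h : BlochVanishing f e) (a : G) : BlochVanishing (fun x => f (x * a)) e :=
  fun u Q s hs => by
    have : blochGen (fun x => f (x * a)) u Q s = blochGen f (u * a) Q s := by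
      simp only [blochGen, mul_right_comm _ _ a]
    rw [this, h (u * a) Q s hs]

/-- With no factors allowed to survive, the map vanishes identically. [folklore] -/
theorem eq_zero (h : BlochVanishing f 0) : f = 0 := by
  funext x
  have := h x (fun _ => 1) ∅ le_rfl
  rwa [blochGen_empty] at this

/-- **One finite difference lowers the degree by one**: if the `(e+1)`-fold differences of `f`
vanish, the `e`-fold differences of `x ↦ f x - f (x a)` vanish. [folklore] -/
theorem sub_mul_right (h : BlochVanishing f (e + 1)) (a : G) :
    BlochVanishing (fun x => f x - f (x * a)) e := fun u Q s hs => by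
  classical
  obtain ⟨m, hm⟩ := Infinite.exists_notMem_finset s
  have hoff : ∀ i ∈ s, Function.update Q m a i = Q i :=
    fun i hi => Function.update_of_ne (ne_of_mem_of_not_mem hi hm) _ _
  have key : blochGen f u (Function.update Q m a) (insert m s) =
      blochGen (fun x => f x - f (x * a)) u Q s := by
    rw [blochGen_insert f u _ hm, Function.update_self, blochGen_congr f u hoff,
      blochGen_congr f (u * a) hoff]
    simp only [blochGen, smul_sub, Finset.sum_sub_distrib, mul_right_comm _ _ a]
  rw [← key]
  exact h u _ _ (by rw [Finset.card_insert_of_notMem hm]; omega)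

/-- A constant map has vanishing first differences. [folklore] -/
theorem const (a : M) : BlochVanishing (fun _ : G => a) 1 := fun u Q s hs => by
  have hne : s.Nonempty := Finset.card_pos.1 hs
  simp only [blochGen]
  rw [← Finset.sum_smul, Finset.sum_powerset_neg_one_pow_card_of_nonempty hne, zero_smul]

/-- **Product rule.** For a homomorphism `B : G → (M →+ N)` (`B (x y) = B x + B y`) and a map `f`
with vanishing `e`-fold differences, `x ↦ B x (f x)` has vanishing `(e+1)`-fold differences
(induction on `e`: `Δ_a (B · f) = B · Δ_a f + B(a) f(· a)`). [folklore] -/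
theorem mulHom_apply {N : Type*} [AddCommGroup N] (B : G → (M →+ N))
    (hB : ∀ x y, B (x * y) = B x + B y) :
    ∀ (e : ℕ) (f : G → M), BlochVanishing f e → BlochVanishing (fun x => B x (f x)) (e + 1) := by
  classical
  intro e
  induction e with
  | zero =>
    intro f hf
    rw [hf.eq_zero]
    have : (fun x : G => B x ((0 : G → M) x)) = 0 := by ext; simp
    rw [this]
    exact zero
  | succ e ih =>
    intro f hf u Q s hs
    obtain ⟨a, ha⟩ : s.Nonempty := Finset.card_pos.1 (by omega)
    have hs' : e + 1 ≤ (s.erase a).card := by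
      rw [Finset.card_erase_of_mem ha]; omega
    -- split off the factor at `a`
    conv_lhs => rw [← Finset.insert_erase ha]
    rw [blochGen_insert _ u Q (Finset.notMem_erase a s)]
    -- `(B·f)(x Q_a) = B x (f (x Q_a)) + B (Q a) (f (x Q_a))`
    have hsplit : blochGen (fun x => B x (f x)) (u * Q a) Q (s.erase a) =
        blochGen (fun x => B x (f (x * Q a))) u Q (s.erase a) +
          B (Q a) (blochGen (fun x => f (x * Q a)) u Q (s.erase a)) := by
      simp only [blochGen, map_sum, map_zsmul, ← Finset.sum_add_distrib, ← smul_add]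
      refine Finset.sum_congr rfl fun S _ => ?_
      rw [mul_right_comm u (Q a), hB, AddMonoidHom.add_apply]
    have hvan : blochGen (fun x => f (x * Q a)) u Q (s.erase a) = 0 := (hf.mul_right (Q a)) u Q _ hs'
    rw [hsplit, hvan, map_zero, add_zero]
    -- the difference is `B · (f - f(· Q_a))`, of lower degree
    have hdiff : blochGen (fun x => B x (f x)) u Q (s.erase a) -
        blochGen (fun x => B x (f (x * Q a))) u Q (s.erase a) =
        blochGen (fun x => B x (f x - f (x * Q a))) u Q (s.erase a) := by
      simp only [blochGen, map_sub, smul_sub, Finset.sum_sub_distrib]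
    rw [hdiff]
    exact ih _ (hf.sub_mul_right (Q a)) u Q _ hs'

end BlochVanishing

/-! ### Iterated "affine" operators: the multi-affine expansion -/

section Iter

variable (C : ℕ → Type*) [∀ n, AddCommGroup (C n)]

/-- The composite `O 0 ∘ O 1 ∘ ⋯ ∘ O (k-1) : C k →+ C 0` of a ladder of additive operators
`O n : C (n+1) →+ C n` (for Chow groups: iterated intersection with divisors down to `CH₀`).
[folklore] -/
def iterOp (O : ∀ n, C (n + 1) →+ C n) : ∀ k, C k →+ C 0
  | 0 => AddMonoidHom.id _
  | k + 1 => (iterOp O k).comp (O k)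

/-- Unfolding: `iterOp O 0 = id`. [folklore] -/
@[simp]
theorem iterOp_zero (O : ∀ n, C (n + 1) →+ C n) (a : C 0) : iterOp C O 0 a = a := rfl

/-- Unfolding: `iterOp O (k+1) a = iterOp O k (O k a)`. [folklore] -/
@[simp]
theorem iterOp_succ (O : ∀ n, C (n + 1) →+ C n) (k : ℕ) (a : C (k + 1)) :
    iterOp C O (k + 1) a = iterOp C O k (O k a) := rfl

variable {C}
variable (O : G → ∀ n, C (n + 1) →+ C n)
  (hO : ∀ (x y : G) (n : ℕ), O (x * y) n + O 1 n = O x n + O y n)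

include hO in
/-- **Multi-affine expansion.** If the operators `O x n` obey the square law
`O (x y) n + O 1 n = O x n + O y n` (so that `x ↦ O x n - O 1 n` is a homomorphism) and `f` has
vanishing `e`-fold differences, then `x ↦ (O x 0 ∘ ⋯ ∘ O x (k-1)) (f x)` has vanishing
`(e+k)`-fold differences. [folklore] -/
theorem blochVanishing_iterOp :
    ∀ (k e : ℕ) (f : G → C k), BlochVanishing f e →
      BlochVanishing (fun x => iterOp C (O x) k (f x)) (e + k) := by
  intro k
  induction k with
  | zero => intro e f hf; simpa using hf
  | succ k ih =>
    intro e f hf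
    -- `O x k (f x) = O 1 k (f x) + (O x k - O 1 k) (f x)`
    set B : G → (C (k + 1) →+ C k) := fun x => O x k - O 1 k with hB
    have hBhom : ∀ x y, B (x * y) = B x + B y := fun x y => by
      simp only [hB]
      rw [eq_sub_of_add_eq (hO x y k)]
      abel
    have hf' : BlochVanishing (fun x => O x k (f x)) (e + 1) := by
      have h1 : BlochVanishing (fun x => O 1 k (f x)) (e + 1) :=
        (hf.addMonoidHom_comp (O 1 k)).mono (Nat.le_succ e)
      have h2 : BlochVanishing (fun x => B x (f x)) (e + 1) := BlochVanishing.mulHom_apply B hBhom e f hf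
      have := h1.add h2
      convert this using 1
      ext x
      simp [hB]
    have := ih (e + 1) _ hf'
    simp only [iterOp_succ]
    convert this using 1
    omega

include hO in
/-- In particular `x ↦ (O x 0 ∘ ⋯ ∘ O x (k-1)) a` has vanishing `(k+1)`-fold differences for a
fixed `a : C k` (for Chow groups: `x ↦ c₁(t_x^*H₁) ⋯ c₁(t_x^*H_g) ∩ [A]` is polynomial of degree
`≤ g` in `x`). [folklore] -/
theorem blochVanishing_iterOp_const (k : ℕ) (a : C k) :
    BlochVanishing (fun x => iterOp C (O x) k a) (k + 1) := by
  have := blochVanishing_iterOp O hO k 1 (fun _ => a) (BlochVanishing.const a)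
  rwa [add_comm] at this

end Iter

/-! ### The filtration consequence: `deg z` kills `Gr^l_F` for `l > g` -/

/-- Linearity of the expanded products in the class map, for translated class maps:
`blochGen (x ↦ Σ_j n_j cls (p_j x)) u Q s = Σ_j n_j blochGen cls (u p_j) Q s`. [folklore] -/
theorem blochGen_sum_smul_translate (cls : G → M) {ι : Type*} (J : Finset ι) (n : ι → ℤ)
    (p : ι → G) {κ : Type*} (u : G) (Q : κ → G) (s : Finset κ) :
    blochGen (fun x => ∑ j ∈ J, n j • cls (p j * x)) u Q s =
      ∑ j ∈ J, n j • blochGen cls (u * p j) Q s := by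
  simp only [blochGen, Finset.smul_sum]
  rw [Finset.sum_comm]
  refine Finset.sum_congr rfl fun j _ => Finset.sum_congr rfl fun S _ => ?_
  rw [smul_comm, mul_left_comm, ← mul_assoc]

/-- **If `z = Σ_j n_j {p_j}` is polynomial of degree `≤ g` under translation, `deg z` kills
`Gr^l_F` for `l > g`.** For a class map `cls : G → M`: if `x ↦ Σ_j n_j cls (p_j x)` has vanishing
`(g+1)`-fold differences, then `(Σ_j n_j) • blochGen cls u Q s ∈ F^{|s|+1}` whenever `|s| > g`
(`(Σ n_j)•Π = Σ_j n_j (Π - {p_j}⋆Π) + Σ_j n_j {p_j}⋆Π`, the first sum having one more factor,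
`blochGen_sub_blochGen_mul_mem`, the second vanishing). [folklore] -/
theorem sum_smul_blochGen_mem_blochFiltrationOf (cls : G → M) {ι : Type*} (J : Finset ι)
    (n : ι → ℤ) (p : ι → G) {g : ℕ}
    (h : BlochVanishing (fun x => ∑ j ∈ J, n j • cls (p j * x)) (g + 1))
    {κ : Type*} (u : G) (Q : κ → G) (s : Finset κ) (hs : g < s.card) :
    (∑ j ∈ J, n j) • blochGen cls u Q s ∈ blochFiltrationOf cls (s.card + 1) := by
  have hvan : ∑ j ∈ J, n j • blochGen cls (u * p j) Q s = 0 := by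
    rw [← blochGen_sum_smul_translate cls J n p u Q s]
    exact h.blochGen_eq_zero u Q s hs
  have key : (∑ j ∈ J, n j) • blochGen cls u Q s =
      ∑ j ∈ J, n j • (blochGen cls u Q s - blochGen cls (u * p j) Q s) +
        ∑ j ∈ J, n j • blochGen cls (u * p j) Q s := by
    rw [Finset.sum_smul, ← Finset.sum_add_distrib]
    refine Finset.sum_congr rfl fun j _ => ?_
    rw [smul_sub, sub_add_cancel]
  rw [key, hvan, add_zero]
  exact AddSubgroup.sum_mem _ fun j _ =>
    AddSubgroup.zsmul_mem _ (blochGen_sub_blochGen_mul_mem cls u (p j) Q s) _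

end Abstract

/-! ### Complex abelian varieties -/

section AbelianVariety

variable (A : AbelianVariety ℂ)

/-- **`Gr^l_F CH₀(A) = 0` for `l > dim A` from a polynomial `0`-cycle of non-zero degree.** If
some `z = Σ_{P ∈ J} n_P {P} ∈ CH₀(A)` with `Σ n_P ≠ 0` is polynomial of degree `≤ dim A` under
translation (`x ↦ Σ n_P {P x}` has vanishing `(dim A + 1)`-fold differences), then
`F^l CH₀(A) = F^{l+1} CH₀(A)` for every `l > dim A`: `Σ n_P` kills `Gr^l_F`
(`sum_smul_blochGen_mem_blochFiltrationOf`) and `Gr^l_F` is divisible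
(`blochFiltration_le_succ_of_smul_mem'`). This is the conclusion of Voisin II, Lemma 11.30, reached
through the degree of `z` instead of `l!`. [cite: VoisinHodgeII2003, Lemma 11.30] -/
theorem AbelianVariety.blochFiltration_le_succ_of_blochVanishing (J : Finset (A.Points ℂ))
    (n : A.Points ℂ → ℤ) (hn : ∑ P ∈ J, n P ≠ 0)
    (h : BlochVanishing (fun x => ∑ P ∈ J, n P • A.pointClass (P * x)) (A.dim + 1))
    {l : ℕ} (hl : A.dim < l) : A.blochFiltration l ≤ A.blochFiltration (l + 1) := by
  set m : ℤ := ∑ P ∈ J, n P with hm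
  refine A.blochFiltration_le_succ_of_smul_mem' (by omega) (Int.natAbs_ne_zero.mpr hn) ?_
  intro u Q s hs
  have hmem : m • blochGen A.pointClass u Q s ∈ A.blochFiltration (l + 1) := by
    have := sum_smul_blochGen_mem_blochFiltrationOf A.pointClass J n id h u Q s (hs ▸ hl)
    rwa [hs] at this
  rcases Int.natAbs_eq m with hcase | hcase
  · rwa [← hcase]
  · have h' : (m.natAbs : ℤ) = -m := by linarith
    rw [h', neg_smul]
    exact (A.blochFiltration (l + 1)).neg_mem hmem

/-- **Bloch's theorem from polynomial `0`-cycles of non-zero degree and Voisin's Lemma 11.31.**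
If every complex abelian variety `A` carries a `0`-cycle `z = Σ n_P {P}` of non-zero degree which
is polynomial of degree `≤ dim A` under translation (supplied by the theorem of the square applied
to `c₁(𝒪_A(1))^g ∩ [A]`, see the sequel files), and `F^N CH₀(A) = 0` for some `N` (Voisin II,
Lemma 11.31: quotient of a Jacobian), then the named fact `Bloch1976_pontryaginPower_eq_zero`
holds (assembly `Bloch1976_pontryaginPower_eq_zero_of_voisin`).
[cite: VoisinHodgeII2003, Thm. 11.29 (proof)] -/
theorem Bloch1976_pontryaginPower_eq_zero_of_blochVanishing_of_eventually_eq_bot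
    (hpoly : ∀ A : AbelianVariety ℂ, ∃ (J : Finset (A.Points ℂ)) (n : A.Points ℂ → ℤ),
      ∑ P ∈ J, n P ≠ 0 ∧
        BlochVanishing (fun x => ∑ P ∈ J, n P • A.pointClass (P * x)) (A.dim + 1))
    (h31 : ∀ A : AbelianVariety ℂ, ∃ N, A.blochFiltration N = ⊥) :
    Bloch1976_pontryaginPower_eq_zero :=
  Bloch1976_pontryaginPower_eq_zero_of_voisin
    (fun A l hl => by
      obtain ⟨J, n, hn, h⟩ := hpoly A
      exact A.blochFiltration_le_succ_of_blochVanishing J n hn h hl)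
    h31

end AbelianVariety

end Literature.AlgebraicGeometry.Motives

end
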